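import Literature.NumberTheory.EllipticCurves.HeegnerPointsOfConductorOneGaloisConjProofs
import Literature.NumberTheory.EllipticCurves.HeegnerPointsRationalityGeneralLevelProofs
import HarnessLib

/-!
# Shimura reciprocity for `y(1)` under BIRCH's condition only: `Gal(K[1]/K)` carries `φ(x(1))`
# bijectively onto the `h_K` Heegner points `φ(τ_Q)` WITHOUT `gcd(N, d_K) = 1` — PROVED

Topic `NumberTheory/EllipticCurves`; theorems only (no definition, no named fact, no `sorry`). Sequel of
`HeegnerPointsOfConductorOneGaloisConjProofs.lean`, which discharges the named fact
`heegnerPointOfConductor_one_galoisConj N W K` (Darmon 2004, Thm. 3.7 at conductor `1`; Gross 1991 §4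
"`P_1 = Σ_{σ ∈ S} σ y_1 = Tr_{K_1/K}(y_1) = y_K`") under the CLASSICAL Heegner hypothesis (every `p ∣ N`
split in `K`). That hypothesis enters its proof at exactly one place: the transport form of Shimura
reciprocity `exists_levelTransport_of_apply_sqrtDisc_eq`, run on the engine
`levelTransport_of_transport_lattice_eq`, which wants `gcd(N, d_K) = 1`. The tree has since acquired the
coprimality-free twin `exists_levelTransport_of_apply_sqrtDisc_eq_bezout`
(`HeegnerPointsRationalityGeneralLevelProofs.lean`, Bezout engine; Gross 1984 §I.1 allows primes dividing
both `N` and `d_K`), so the same statement holds under Birch's condition `4N ∣ β² − d_K` ALONE — the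
generality of Cai–Shu–Tian's Heegner condition (primes `p ∥ N` may ramify in `K`; Cai–Shu–Tian 2014 §1,
p. 2524: "no prime divisor `p` of `N` is inert in `K`, and also `p` must be split in `K` if `p² ∣ N`").

* `HeegnerDatum.card_reps_eq_classNumber_of_isImaginaryQuadratic` — `#H.reps = h(K)` with the (unused)
  Heegner-hypothesis binder of the named fact `HeegnerDatum.card_reps_eq_classNumber` removed (same
  proof as `HeegnerDatum.card_reps_eq_classNumber_holds`, whose docstring records "The Heegner
  hypothesis is not used");
* `heegnerPointOfConductor_one_galoisConj_birch` — for a conductor-`1` Kolyvagin–Heegner datum `d` and a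
  Heegner datum `H` of discriminant `d_K` with `H.β = β`: a bijection `e : d.S ≃ H.reps` with
  `s • y(1) ↦ φ(τ_{e s})` in `E(ℂ)`; NO Heegner hypothesis.

Consumer: the trivial-character case of Cai–Shu–Tian 2014 Thm. 1.1 under the general Heegner condition
(`Summits/BirchSwinnertonDyer/…/Theorems/AdditiveBranchIMCExplicitGrossZagierTrivialCharOfRingClass.lean`,
LEAD `cruxlead-stmt-BirchSwinnertonDyer-19357`, line `three_field_road`).

## References

* [Darmon2004] H. Darmon, *Rational Points on Modular Elliptic Curves*, CBMS 101, AMS (2004),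
  Thm. 3.7 (PDF p. 44), §3.7 (PDF p. 49).
* [GrossLMS1991] B. H. Gross, *Kolyvagin's work on modular elliptic curves*, LMS Lecture Note
  Ser. 153, CUP (1991), 235–256, §4 (p. 241, `P_1 = Tr y_1 = y_K`).
* [Gross1984] B. H. Gross, *Heegner points on `X₀(N)`*, in *Modular Forms* (Durham 1983), 1984, §I.1.
* [CaiShuTian2014] L. Cai, J. Shu, Y. Tian, ANT 8 (2014), §1 p. 2524 (the Heegner condition).

## Mathlib / tree search

`rg 'galoisConj_birch|card_reps_eq_classNumber_of'` over `lean/`: nothing (2026-08-29). Reused by name: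
`exists_levelTransport_of_apply_sqrtDisc_eq_bezout`, `HeegnerDatum.exists_isGamma0Equiv`, `LevelTransport.of_gamma0_smul_eq_right`,
`ModularParametrizationData.isAutEquivariantOnHeegner`, `eqOn_ringClassField_of_apply_kleinJ_eq`,
`classNumber_le_finrank_ringClassField`, `card_reducedForms_eq_classNumber`.
-/

noncomputable section

open scoped Classical Cardinal MatrixGroups nonZeroDivisors

universe u

namespace Literature.NumberTheory.EllipticCurves

open Complex UpperHalfPlane CongruenceSubgroup PeriodPair ModularForms Cardinal NumberField Module
open Literature.NumberTheory.QuadraticFields.BinaryQuadraticForm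
open Literature.NumberTheory.QuadraticFields.Quadratic
open Literature.FieldTheory.AlgClosed

/-! ### The count `#H.reps = h(K)` without the Heegner-hypothesis binder -/

section Count

variable {K : Type u} [Field K] [NumberField K]

/-- **`#H.reps = h(K)` for every Heegner datum of discriminant `d_K`, `K` imaginary quadratic** (Gross
1984, §I.1; Gross–Kohnen–Zagier 1987, §I.1, pp. 504–505): the number of `Γ₀(N)`-classes of Heegner
forms `(A, B, C)` of level `N`, discriminant `d_K` and `B ≡ β (mod 2N)` is the class number `h(K)` —
the named fact `HeegnerDatum.card_reps_eq_classNumber N K` WITHOUT its (idle) Heegner-hypothesis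
binder. Proof verbatim that of `HeegnerDatum.card_reps_eq_classNumber_holds`: `Q ↦ [𝔞_Q] ∈ Cl(𝓞 K)`,
`𝔞_Q = (A, ω − (B + t)/2)`, is injective on `H.reps` (`isGamma0Equiv_of_span_mul_formIdeal_eq`,
irredundancy) and surjective (`exists_heegnerForm_mk0_formIdeal_eq`, completeness,
`exists_span_mul_formIdeal_eq_of_isGamma0Equiv`). [cite: Gross1984, §I.1] -/
theorem HeegnerDatum.card_reps_eq_classNumber_of_isImaginaryQuadratic {N : ℕ} [NeZero N]
    (hK : IsImaginaryQuadratic K) (H : HeegnerDatum N (NumberField.discr K)) :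
    H.reps.card = NumberField.classNumber K := by
  classical
  obtain ⟨b, hb⟩ := exists_basis_zero_eq_one hK.1
  set t : ℤ := b.repr (b 1 * b 1) 1 with ht
  set m : ℤ := b.repr (b 1 * b 1) 0 with hm
  have hω : b 1 * b 1 = (m : 𝓞 K) + (t : 𝓞 K) * b 1 := basis_one_mul_self_eq b hb
  have hD : NumberField.discr K = t ^ 2 + 4 * m := discr_eq_sq_add_four_mul b hb
  have hneg : t ^ 2 + 4 * m < 0 := hD ▸ hK.discr_neg
  have hmem : ∀ Q ∈ H.reps, Q ∈ heegnerForms N (t ^ 2 + 4 * m) ∧ Q.2.1 ≡ H.β [ZMOD 2 * N] := by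
    intro Q hQ
    obtain ⟨h1, h2⟩ := H.mem_heegnerForms Q hQ
    rw [hD] at h1
    exact ⟨h1, h2⟩
  have hβ : (4 * N : ℤ) ∣ H.β ^ 2 - (t ^ 2 + 4 * m) := by
    rw [← hD]
    exact H.dvd_sq_sub
  -- the map `Q ↦ [𝔞_Q]`
  have h0 : ∀ Q ∈ H.reps,
      Ideal.span {(Q.1 : 𝓞 K), b 1 - (((Q.2.1 + t) / 2 : ℤ) : 𝓞 K)} ∈ (Ideal (𝓞 K))⁰ :=
    fun Q hQ ↦ by
      obtain ⟨⟨-, hA, -, -⟩, -⟩ := hmem Q hQ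
      exact span_pair_mem_nonZeroDivisors b hb hA.ne' _
  let f : H.reps → ClassGroup (𝓞 K) := fun Q ↦ ClassGroup.mk0 ⟨_, h0 Q.1 Q.2⟩
  have hf_inj : Function.Injective f := by
    rintro ⟨Q₁, h₁⟩ ⟨Q₂, h₂⟩ heq
    change ClassGroup.mk0 _ = ClassGroup.mk0 _ at heq
    obtain ⟨x, y, hx, -, hxy⟩ := ClassGroup.mk0_eq_mk0_iff.mp heq
    have hequiv : IsGamma0Equiv N Q₁ Q₂ :=
      isGamma0Equiv_of_span_mul_formIdeal_eq b hb hω hneg (hmem Q₁ h₁).1 (hmem Q₂ h₂).1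
        ((hmem Q₁ h₁).2.trans (hmem Q₂ h₂).2.symm) hx hxy
    by_contra hne
    exact H.pairwise_not_isGamma0Equiv h₁ h₂ (fun h ↦ hne (Subtype.ext h)) hequiv
  have hf_surj : Function.Surjective f := by
    intro c
    obtain ⟨Q₀, hQ₀, hβ₀, h00, hc⟩ := exists_heegnerForm_mk0_formIdeal_eq b hb hω hneg hβ c
    obtain ⟨Q', hQ', heqv⟩ := H.exists_isGamma0Equiv Q₀ (by rw [hD]; exact hQ₀) hβ₀
    refine ⟨⟨Q', hQ'⟩, ?_⟩
    obtain ⟨hd₀, hA₀, -, -⟩ := hQ₀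
    obtain ⟨⟨hd', hA', -, -⟩, -⟩ := hmem Q' hQ'
    obtain ⟨x, y, hx, hy, hxy⟩ :=
      exists_span_mul_formIdeal_eq_of_isGamma0Equiv b hb hω hneg hA₀ hd₀ hA' hd' heqv
    rw [← hc]
    change ClassGroup.mk0 _ = ClassGroup.mk0 _
    exact ClassGroup.mk0_eq_mk0_iff.mpr ⟨y, x, hy, hx, hxy.symm⟩
  have hcard := Fintype.card_of_bijective ⟨hf_inj, hf_surj⟩
  rw [Fintype.card_coe] at hcard
  rw [hcard]
  rfl

end Count

/-! ### Darmon 2004, Thm. 3.7 / Gross 1991 §4 for `y(1)`, under Birch's condition only -/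

section Main

/-- `K[n]` is countable (`K[n]/K` finite for `n ≠ 0`; twin of the private helper of
`HeegnerPointsOfConductorOneGaloisConjProofs`). [folklore] -/
private theorem cardinalMk_ringClassField_le_birch {K : Type u} [Field K] [NumberField K]
    (hK : IsImaginaryQuadratic K) (ι : K →+* ℂ) {n : ℕ} (hn : n ≠ 0) :
    #(ringClassField K ι n) ≤ ℵ₀ := by
  haveI := (finiteDimensional_and_isGalois_ringClassField hK ι hn).1
  haveI : FiniteDimensional ℚ (ringClassField K ι n) := Module.Finite.trans K (ringClassField K ι n)
  haveI : Algebra.IsAlgebraic ℚ (ringClassField K ι n) := Algebra.IsAlgebraic.of_finite ℚ _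
  exact Subfield.cardinalMk_le_aleph0_of_isAlgebraic _

variable (N : ℕ) [NeZero N] (W : WeierstrassCurve ℚ) (K : Type) [Field K] [NumberField K]

/-- **Shimura reciprocity for the Heegner point of conductor `1`, NO Heegner hypothesis**: for
`E/ℚ` elliptic (model `W`), `K` imaginary quadratic, a parametrisation datum `Dt` at level `N`, an
orientation `β`, an embedding `ι`, a Kolyvagin–Heegner datum `d` of conductor `1` (`d.y = y(1) ∈ E(K[1])`
over `φ(x(1))`, `d.S = Gal(K[1]/K)`) and a Heegner datum `H` of discriminant `d_K` with `H.β = β` (so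
`4N ∣ β² − d_K`, Birch's condition — nothing more is assumed), there is a bijection `e : d.S ≃ H.reps` such
that the complex point of `s • y(1)` is `φ(τ_{e s})` for every `s ∈ d.S`. Darmon 2004, Thm. 3.7
("`Φ_N(α ⋆ τ) = rec(α⁻¹) Φ_N(τ)`") with Gross 1991 §4 ("`P_1 = Σ_{σ ∈ S} σ y_1 = Tr_{K_1/K}(y_1) = y_K`");
the statement of the named fact `heegnerPointOfConductor_one_galoisConj N W K` with its Heegner-hypothesis
binder removed. Proof = that of `heegnerPointOfConductor_one_galoisConj_holds` with
`exists_levelTransport_of_apply_sqrtDisc_eq_bezout` (Bezout engine) in place of the coprime engine and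
the binder-free count `HeegnerDatum.card_reps_eq_classNumber_of_isImaginaryQuadratic`.
[cite: Darmon2004, Thm. 3.7 (PDF p. 44) and §3.7 (PDF p. 49)]
[cite: GrossLMS1991, §4 (P_1 = Tr y_1 = y_K) and §1 (pp. 235–236)] [cite: Gross1984, §I.1] -/
theorem heegnerPointOfConductor_one_galoisConj_birch [W.IsElliptic] (hK : IsImaginaryQuadratic K)
    (Dt : ModularParametrizationData W N) (β : ℤ) (ι : K →+* ℂ) (d : KolyvaginHeegnerData Dt β ι 1)
    (H : HeegnerDatum N (NumberField.discr K)) (hHβ : H.β = β) :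
    ∃ e : d.S ≃ H.reps, ∀ s : d.S,
      WeierstrassCurve.Affine.Point.map (ringClassField K ι 1).subtype.toRatAlgHom
          (pointGalHom W (ringClassField K ι 1) (s : _ ≃ₐ[ℚ] _) d.y) =
        Dt.φ (heegnerTau ((e s : ℤ × ℤ × ℤ))) := by
  subst hHβ
  have hD : NumberField.discr K < 0 := hK.discr_neg
  -- `Q_1 = ((β² − d_K)/4, β, 1)`, the form of `x(1)`: a Heegner form of residue `β`
  obtain ⟨hQ1, hQ1β⟩ :=
    heegnerFormOfConductor_mem_heegnerForms (N := N) hD H.dvd_sq_sub (one_ne_zero (α := ℕ))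
  simp only [Nat.cast_one, one_pow, one_mul] at hQ1 hQ1β
  -- extend every `s ∈ S` to an automorphism `σ_s` of `ℂ`
  have hFc : #(ringClassField K ι 1) ≤ ℵ₀ := cardinalMk_ringClassField_le_birch hK ι one_ne_zero
  have hext : ∀ s : d.S, ∃ σ : ℂ ≃+* ℂ, ∀ x : (ringClassField K ι 1),
      σ x = (((s : (ringClassField K ι 1) ≃ₐ[ℚ] (ringClassField K ι 1)) x :
        (ringClassField K ι 1)) : ℂ) := fun s ↦
    Complex.exists_ringEquiv_apply_eq_of_subfield (ringClassField K ι 1) hFc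
      ((ringClassField K ι 1).subtype.comp
        (s : (ringClassField K ι 1) ≃ₐ[ℚ] (ringClassField K ι 1)).toRingEquiv.toRingHom)
  choose σ hσ using hext
  have hσK : ∀ (s : d.S) (k : K), σ s (ι k) = ι k := by
    intro s k
    have hs : (s : (ringClassField K ι 1) ≃ₐ[ℚ] (ringClassField K ι 1)) ∈ ringClassGal ι 1 :=
      (d.mem_S_iff _).mp s.2
    have hfix := smul_algebraMap_of_mem_ringClassGal hs k
    rw [← coe_algebraMap_ringClassField ι 1 k, hσ s, hfix]
  have hσD : ∀ s : d.S, σ s (sqrtDisc (NumberField.discr K)) = sqrtDisc (NumberField.discr K) :=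
    fun s ↦ apply_sqrtDisc_discr_eq hK ι (hσK s)
  -- transport `x(1)` by `σ_s` onto a representative (Bezout engine: no `gcd(N, d_K) = 1`)
  have key : ∀ s : d.S, ∃ r : H.reps,
      LevelTransport N (σ s) (heegnerTau (heegnerFormOfConductor (NumberField.discr K) H.β 1))
        (heegnerTau (r : ℤ × ℤ × ℤ)) := by
    intro s
    obtain ⟨Q', hQ', hβ', hT⟩ :=
      exists_levelTransport_of_apply_sqrtDisc_eq_bezout hK H.dvd_sq_sub (hσD s) hQ1 hQ1β
    obtain ⟨r, hr, γ, hγ⟩ := H.exists_isGamma0Equiv Q' hQ' hβ'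
    refine ⟨⟨r, hr⟩, hT.of_gamma0_smul_eq_right (γ := γ) ?_⟩
    rw [← hγ, Subgroup.smul_def]
  choose E hE using key
  -- the parametrisation is `Aut(ℂ)`-equivariant along the transport
  have hφ : Dt.IsAutEquivariantOnHeegner (NumberField.discr K) := Dt.isAutEquivariantOnHeegner _
  have hval : ∀ s : d.S,
      WeierstrassCurve.Affine.Point.map (ringClassField K ι 1).subtype.toRatAlgHom
          (pointGalHom W (ringClassField K ι 1) (s : _ ≃ₐ[ℚ] _) d.y) =
        Dt.φ (heegnerTau ((E s : ℤ × ℤ × ℤ))) := by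
    intro s
    have hy : WeierstrassCurve.Affine.Point.map (ringClassField K ι 1).subtype.toRatAlgHom d.y =
        Dt.φ (heegnerTau (heegnerFormOfConductor (NumberField.discr K) H.β 1)) := by
      simpa only [heegnerPointComplexOfConductor, heegnerPointOfConductor] using d.map_y
    calc WeierstrassCurve.Affine.Point.map (ringClassField K ι 1).subtype.toRatAlgHom
            (pointGalHom W (ringClassField K ι 1) (s : _ ≃ₐ[ℚ] _) d.y)
        = WeierstrassCurve.Affine.Point.map ((σ s : ℂ →+* ℂ)).toRatAlgHom
            (WeierstrassCurve.Affine.Point.map (ringClassField K ι 1).subtype.toRatAlgHom d.y) := by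
          rw [pointGalHom_apply, WeierstrassCurve.Affine.Point.map_map,
            WeierstrassCurve.Affine.Point.map_map]
          exact WeierstrassCurve.Affine.Point.map_congr_fun (fun x ↦ (hσ s x).symm) _
      _ = Dt.φ (heegnerTau ((E s : ℤ × ℤ × ℤ))) := by
          rw [hy]
          exact hφ (σ s) (hσD s) hQ1 (H.mem_heegnerForms _ (E s).2).1 (hE s)
  -- `E` is injective: `K[1] = ι(K)(j(x(1)))`
  have hinj : Function.Injective E := by
    intro s s' hss'
    have h1 := (hE s).kleinJ_eq
    have h2 := (hE s').kleinJ_eq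
    rw [hss'] at h1
    have hj : σ s (kleinJ (heegnerPointOfConductor (NumberField.discr K) H.β 1)) =
        σ s' (kleinJ (heegnerPointOfConductor (NumberField.discr K) H.β 1)) :=
      h1.symm.trans h2
    have hKφψ : ∀ k : K, (σ s).toRingHom (ι k) = (σ s').toRingHom (ι k) := fun k ↦ by
      rw [RingEquiv.toRingHom_eq_coe, RingEquiv.coe_toRingHom, RingEquiv.toRingHom_eq_coe,
        RingEquiv.coe_toRingHom, hσK s k, hσK s' k]
    have hj' : (σ s).toRingHom (kleinJ (heegnerPointOfConductor (NumberField.discr K) H.β 1)) =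
        (σ s').toRingHom (kleinJ (heegnerPointOfConductor (NumberField.discr K) H.β 1)) := by
      rw [RingEquiv.toRingHom_eq_coe, RingEquiv.coe_toRingHom, RingEquiv.toRingHom_eq_coe,
        RingEquiv.coe_toRingHom]
      exact hj
    have heq := eqOn_ringClassField_of_apply_kleinJ_eq (N := N) (β := H.β) (n := 1)
      (φ := (σ s).toRingHom) (ψ := (σ s').toRingHom) hK ι H.dvd_sq_sub one_ne_zero hKφψ hj'
    apply Subtype.ext
    ext x
    have hx : σ s x = σ s' x := by
      have := heq x.2
      rwa [RingEquiv.toRingHom_eq_coe, RingEquiv.coe_toRingHom, RingEquiv.toRingHom_eq_coe,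
        RingEquiv.coe_toRingHom] at this
    rw [hσ s x, hσ s' x] at hx
    rw [Subtype.ext hx]
  -- `E` is surjective by counting: `#H.reps = h_K ≤ [K[1] : K] = #Aut_K(K[1]) ≤ #S`
  haveI := (finiteDimensional_and_isGalois_ringClassField hK ι one_ne_zero).1
  haveI := (finiteDimensional_and_isGalois_ringClassField hK ι one_ne_zero).2
  have hreps : Fintype.card H.reps = NumberField.classNumber K := by
    rw [Fintype.card_coe]
    exact HeegnerDatum.card_reps_eq_classNumber_of_isImaginaryQuadratic hK H
  let f : ((ringClassField K ι 1) ≃ₐ[K] (ringClassField K ι 1)) → d.S := fun τ ↦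
    ⟨τ.restrictScalars ℚ, (d.mem_S_iff _).mpr (by
      rw [ringClassGal, mem_fixingSubgroup_iff]
      rintro x ⟨k, hk⟩
      have hx : x = algebraMap K (ringClassField K ι 1) k := Subtype.ext hk.symm
      rw [hx, AlgEquiv.smul_def, AlgEquiv.restrictScalars_apply]
      exact τ.commutes k)⟩
  have hf : Function.Injective f := fun τ τ' h ↦
    AlgEquiv.restrictScalars_injective ℚ (congrArg Subtype.val h)
  have hS : NumberField.classNumber K ≤ Fintype.card d.S := by
    have h1 : NumberField.classNumber K ≤ Module.finrank K (ringClassField K ι 1) := by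
      rw [← card_reducedForms_eq_classNumber hK.1 hD]
      simpa using classNumber_le_finrank_ringClassField hK ι (n := 1) one_ne_zero
    have h2 : Module.finrank K (ringClassField K ι 1) =
        Nat.card ((ringClassField K ι 1) ≃ₐ[K] (ringClassField K ι 1)) :=
      (IsGalois.card_aut_eq_finrank K (ringClassField K ι 1)).symm
    have h3 : Nat.card ((ringClassField K ι 1) ≃ₐ[K] (ringClassField K ι 1)) ≤ Nat.card d.S :=
      Nat.card_le_card_of_injective f hf
    simp only [Nat.card_eq_fintype_card] at h2 h3
    omega
  have hbij : Function.Bijective E :=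
    (Fintype.bijective_iff_injective_and_card E).mpr
      ⟨hinj, le_antisymm (Fintype.card_le_of_injective E hinj) (hreps ▸ hS)⟩
  exact ⟨Equiv.ofBijective E hbij, fun s ↦ hval s⟩

end Main

end Literature.NumberTheory.EllipticCurves

end
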